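import Summits.PneNP.PneNP.Theses.RamseyUncertifiable
import Summits.PneNP.PneNP.Theorems.RamseyUncertifiableRamseyInCoNP
import Literature.Combinatorics.SimpleGraph.RamseyNumbers
import Literature.Computability.Complexity.HamCircuitNP
import Literature.Computability.Complexity.FinitePatching
import Literature.Computability.Complexity.LengthCompare
import Literature.Computability.Complexity.BranchingFn
import Literature.Computability.Complexity.NPClosureProofs

/-!
# Disproof work file for the crux `RamseyNotNP` (stmt-PneNP-9814, route PneNP/RamseyUncertifiable) — cycle 1

Standing adversary (cdisprove) on
`Summit.PneNP.PneNP.Theses.RamseyUncertifiable.RamseyNotNP`: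

  RAMSEY₂ := encodingGraph.toLanguage {⟨n, G⟩ | G.CliqueFree ⌈log₂ n²⌉ ∧ Gᶜ.CliqueFree ⌈log₂ n²⌉} ∉ NP.

VERDICT SO FAR: **not refuted, not mis-stated.**  `¬ RamseyNotNP` is LITERALLY the statement
`RAMSEY₂ ∈ NP` (§1), i.e. a polynomial-size certificate scheme for Ramsey-ness of every Ramsey graph at
the Erdős threshold `⌈2 log₂ n⌉` — an open problem (nothing below `√n` is certifiable even for Paley
graphs); and `RamseyNotNP` itself implies `coNP ≠ NP` (§1, with the LANDED support `ramseyInCoNP_proof`),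
so neither side is reachable by search.  The statement elaborates, the encoding is the honest row-major
adjacency code (input length `Θ(n²)`), `NP = ∃·P` over Mathlib's `FinTM2` (finite control, finitely many
stacks; no infinite-alphabet / infinite-state loophole: `σ`, `Λ`, `K` are `Fintype`), and the language is
infinite and co-infinite inside the code words (§5), so no finiteness / triviality refutation exists.

FINDINGS, as theorems (sorry-free unless marked):

* §0 `ramseyNotNP_iff` — read-back: the crux is `RamseyNotNPAt thr`, `thr n = Nat.clog 2 (n ^ 2) = ⌈2 log₂ n⌉`
  (`thr_two_pow : thr (2^m) = 2m`); membership sanity: sizes `0, 1, 2` contribute nothing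
  (`CliqueFree 0` is false; on two vertices the one pair is homogeneous), EVERY graph on `3` vertices is a
  member (`thr 3 = 4`), complete graphs on `n ≥ 4` vertices are non-members.
* §1 `not_ramseyNotNP_iff` — a disproof IS an NP-membership proof; `not_ramseyNotNP_of_coNP_eq_NP` — the
  collapse `coNP = NP` refutes the crux (so a refutation is at most as hard as `NP = coNP` and at least as
  hard as certifying Ramsey-ness); `coNP_ne_NP_of_ramseyNotNP`, `NP_ne_P_of_ramseyNotNP`, `pneNP_of_ramseyNotNP`
  — the crux alone already closes the summit (the support item is landed).  ROUTE NOTE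
  `ramseyLang_thr_mem_P_of_not_pneNP`: the WEAKER target `RAMSEY₂ ∉ P` closes the summit through the same assembly; the crux as filed is
  stronger than needed by exactly the commitment `coNP ≠ NP` (`ramseyNotP_of_ramseyNotNP`).
* §2 LOAD-BEARING (threshold from below) `not_ramseyNotNPAt_of_fourPow` — if `4^{k n} ≤ n` for all large
  `n` then `RAMSEY_k` is FINITE (Erdős–Szekeres `R(k,k) ≤ 4^k`, tree fact `ramsey_diagonal_le_four_pow_holds`)
  hence in `P ⊆ NP`: every constant threshold, `k n = ⌊log₄ n⌋`, `k n = ⌊log₂ n⌋ / 2` are refuted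
  thresholds.  So the constant `2` in `2 log₂ n` cannot drop to `1/2`; for `1/2 < c < 2` even the
  infinitude of the language is the open diagonal-Ramsey growth problem.
* §3 LOAD-BEARING (threshold from above) `not_ramseyNotNPAt_of_lt` — if `n < k n` for all `n` the language
  is the set of graph code words, which is in `P` (`HamNP.gcodeLang_mem_P`).
* §4 `ramseyNotNPAt_congr` — only the EVENTUAL behaviour of the threshold matters (`NP` is closed under
  finite modification, `mem_NP_of_finite_modification`), so §2/§3 hold with "for all large `n`".
* §5 NECESSARY CONDITIONS met by the crux: `infinite_of_ramseyNotNPAt` / `coinfinite_of_ramseyNotNPAt`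
  (an NP-outsider is infinite and co-infinite among code words) — and both hold at `thr`:
  `ramseyLang_thr_infinite` (Erdős 1947 along `n = 2^m`, tree fact `erdos1947_ramsey_lower_holds`:
  `C(2^m, 2m)·2^{1-C(2m,2)} ≤ 2^{m+1}/(2m)! < 1`) and `ramseyLang_thr_coinfinite` (complete graphs).
* §6 STRENGTHENINGS refuted: `not_ramseyNotCoNP` (RAMSEY₂ ∉ coNP is false — landed support);
  `not_forall_threshold` (the universal closure over thresholds is false).
* §7 INSTANCE FORM `ramseyNotNPAt_iff_forall_NP_misses_infinite`: the crux ⟺ every NP family of (codes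
  of) Ramsey graphs misses infinitely many Ramsey graphs.  The LPRT-flavoured strengthenings "every
  certifiable family is finite" = `RamseyNPImmuneAt` ⟹ `RamseyPImmuneAt` ⟹ … imply the crux
  (`ramseyNotNPAt_of_NPImmune`) but `P`-immunity at `thr` is the NEGATION of Erdős' explicit-construction
  problem (a poly-time printable infinite family of `⌈2log₂n⌉`-Ramsey graphs) — open, and widely expected to
  fail; planners should not upgrade the crux to immunity.  Immunity dies wherever §2/§3 bite.
* §8 `inter_mem_NP` (NP ∩ NP ⊆ NP, apparently missing from the trunk) and the ONE-SIDED CONSEQUENCE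
  `oneSided_of_ramseyNotNPAt`: the crux forces `CLIQUEFREE_{2log₂n} ∉ NP ∨ INDEPFREE_{2log₂n} ∉ NP`
  (`ramseyLangAt_eq_inter`), although the route's SoS engine only addresses the two-sided language.
* §9 COMPLEMENT SYMMETRY `exists_complFn` (the map `code G ↦ code Gᶜ` is in `FP`, typed `CodeFP` calculus),
  `cliqueFree_mem_NP_iff` / `cliqueFree_mem_P_iff` (`CLIQUEFREE_k ∈ NP ↔ INDEPFREE_k ∈ NP`, same in `P`),
  hence `cliqueFree_not_mem_NP_of_ramseyNotNPAt`: the crux forces `CLIQUEFREE_{⌈2log₂n⌉} ∉ NP` outright.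
* §10 TARGET LATTICE `targetLattice`: `RamseyNotNP ⟹ CLIQUEFREE_thr ∉ NP ⟹ CLIQUEFREE_thr ∉ P`,
  `RamseyNotNP ⟹ RAMSEY₂ ∉ P ⟹ CLIQUEFREE_thr ∉ P`, and the BOTTOM node already closes the summit
  (`cliqueFreeLang_thr_mem_P_of_not_pneNP`, via `cliqueFreeLang_thr_mem_coNP`: `CLIQUEFREE_thr ∈ coNP` by the tree's
  `CLIQUE_mem_NP` pulled back along the FP threshold pairing `exists_thrPairFn`).  So the filed crux is the
  TOP of a lattice of summit-sufficient targets whose bottom is the classical "`ω(G) < ⌈2log₂ n⌉` is not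
  decidable in P" (LOGCLIQUE ∉ P, a consequence of ETH) — planners may weaken X two steps without losing
  the summit; the extra strength buys only `coNP ≠ NP` and two-sidedness for the SoS mechanism.
* §11 DATA POINT `ramseyLangAt_self_mem_P`, `not_ramseyNotNPAt_self`, `ramseySetAt_self_infinite`: at the
  threshold `k n = n` the language (non-homogeneous graphs) is infinite, co-infinite and in `P` (CodeFP
  non-homogeneity test) — the crux shape is not monotone in `k` and §5's necessary conditions are not
  sufficient.
* §12 LINE `Sketch` (picked): stubs survive cheap attacks; joint sufficiency is kernel-checked in the skeleton;
  load-bearing parameter range `0 < ε < 1/2` for the planted stubs (`not_thresholdBelowPoly_of_half_le`; nPCR(ε)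
  false for ε < 0 by ϑ on paper, vacuous for ε ≥ 1/2); the skeleton's `XImpliesY` is PROVED
  (`LineSketch.cliqueSideNotNP_of_ramseyNotNP`).

LANDED (tree, `Summits/PneNP/PneNP/Theorems/RamseyNotNP/Negative/`, importable by ideators / planners / the lead):
`ThresholdLoadBearing.lean` (§0, §2–§5, §7 instance form; p83009, commit 6ad6eef97fec), `Sandwich.lean` (§1, §5',
§6, §8; p84267, commit af552d235d24), `ComplementSymmetry.lean` (§9–§10; p87388, commit 005991b96ac4),
`ThresholdSelf.lean` (§11; p97009, commit 44c8c5612b05).  `import Summits.PneNP.PneNP.Theorems.RamseyNotNP.Negative.ComplementSymmetry`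
pulls ThresholdLoadBearing and Sandwich.

WHY IT RESISTS (for ideators/provers).  Refuting needs RAMSEY₂ ∈ NP: a verifier accepting, for EVERY
graph with `ω, α < ⌈2log₂ n⌉`, some poly-size witness — i.e. a sound and complete proof system for
Ramsey-ness with polynomial-size proofs.  Known certification reaches only `ω ≤ √n`-type bounds (spectral /
ϑ / SoS degree O(1)), and for G(n,½) degree-d SoS cannot certify `ω < n^{1/2-ε}` (BHKKMP16); no explicit
`2log₂n`-Ramsey graphs are even known (Erdős' construction problem), let alone certified ones.  Proving the
crux needs `NP ≠ coNP`.  Hence this seat's output is structural: which thresholds are dead (§2–§4) and which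
sanity conditions the crux provably meets (§5).

Refuter seat cdisprove-stmt-PneNP-9814 gen 1 (cycle 1), 2026-08-16.
-/

set_option linter.dupNamespace false

namespace Summit.PneNP.PneNP.Cruxes.RamseyNotNP.Disproof

open Literature.Computability.Complexity _root_.Computability
open Summit.PneNP.PneNP.Theses.RamseyUncertifiable (RamseyNotNP RamseyInCoNP)

/-! ## §0 Read-back and sanity -/

/-- The Ramsey set at a threshold function `k`: graphs `⟨n, G⟩` with no clique and no independent set
of size `k n`. [folklore] -/
def ramseySetAt (k : ℕ → ℕ) : Set (Σ n, SimpleGraph (Fin n)) :=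
  {p | p.2.CliqueFree (k p.1) ∧ p.2ᶜ.CliqueFree (k p.1)}

/-- Its language of adjacency code words. [folklore] -/
def ramseyLangAt (k : ℕ → ℕ) : Language Bool :=
  encodingGraph.toLanguage (ramseySetAt k)

/-- The crux shape at threshold `k`: `RAMSEY_k ∉ NP`. [folklore] -/
def RamseyNotNPAt (k : ℕ → ℕ) : Prop :=
  ramseyLangAt k ∉ Nondeterministic.NP

/-- The crux threshold `⌈log₂ (n²)⌉ = ⌈2 log₂ n⌉`. [folklore] -/
def thr (n : ℕ) : ℕ := Nat.clog 2 (n ^ 2)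

/-- **Read-back.** The crux is `RamseyNotNPAt thr`, definitionally. [folklore] -/
theorem ramseyNotNP_iff : RamseyNotNP ↔ RamseyNotNPAt thr := Iff.rfl

/-- The language of the crux is `ramseyLangAt thr`, definitionally. [folklore] -/
theorem ramseyLang_thr_eq :
    ramseyLangAt thr = encodingGraph.toLanguage {p : Σ n, SimpleGraph (Fin n) |
      p.2.CliqueFree (Nat.clog 2 (p.1 ^ 2)) ∧ p.2ᶜ.CliqueFree (Nat.clog 2 (p.1 ^ 2))} := rfl

/-- Small values of the threshold: `thr n = ⌈2 log₂ n⌉`. [folklore] -/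
theorem thr_values : thr 0 = 0 ∧ thr 1 = 0 ∧ thr 2 = 2 ∧ thr 3 = 4 ∧ thr 4 = 4 ∧ thr 5 = 5 ∧
    thr 6 = 6 ∧ thr 7 = 6 ∧ thr 8 = 6 ∧ thr 9 = 7 ∧ thr 11 = 7 ∧ thr 12 = 8 ∧ thr 16 = 8 ∧ thr 17 = 9 := by
  decide

/-- Dyadic sizes: `thr (2^m) = 2m`. [folklore] -/
theorem thr_two_pow (m : ℕ) : thr (2 ^ m) = 2 * m := by
  unfold thr
  rw [← pow_mul, Nat.clog_pow 2 _ one_lt_two, mul_comm]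

/-- `thr n ≤ n` for `n ≥ 4` (as `n² ≤ 2ⁿ`). [folklore] -/
theorem thr_le_self {n : ℕ} (hn : 4 ≤ n) : thr n ≤ n := by
  unfold thr
  refine Nat.clog_le_of_le_pow ?_
  induction n, hn using Nat.le_induction with
  | base => norm_num
  | succ n hn ih =>
    have : 2 * n + 1 ≤ n ^ 2 := by nlinarith
    calc (n + 1) ^ 2 = n ^ 2 + (2 * n + 1) := by ring
      _ ≤ 2 ^ n + 2 ^ n := Nat.add_le_add ih (this.trans ih)
      _ = 2 ^ (n + 1) := by ring

/-- Sizes `0` and `1` contribute no member (`CliqueFree 0` fails). [folklore] -/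
theorem not_mem_of_size_le_one {p : Σ n, SimpleGraph (Fin n)} (hp : p.1 ≤ 1) : p ∉ ramseySetAt thr := by
  rintro ⟨h, -⟩
  have h0 : thr p.1 = 0 := by
    unfold thr
    exact Nat.clog_of_right_le_one (by nlinarith) 2
  rw [h0] at h
  exact SimpleGraph.not_cliqueFree_zero h

/-- Size `2` contributes no member: the unique pair is an edge of `G` or of `Gᶜ`. [folklore] -/
theorem not_mem_of_size_two (G : SimpleGraph (Fin 2)) :
    (⟨2, G⟩ : Σ n, SimpleGraph (Fin n)) ∉ ramseySetAt thr := by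
  rintro ⟨h1, h2⟩
  have ht : thr 2 = 2 := by decide
  simp only [ht] at h1 h2
  rw [SimpleGraph.cliqueFree_two] at h1 h2
  rw [h1, compl_bot] at h2
  have : (⊤ : SimpleGraph (Fin 2)).Adj 0 1 := by decide
  rw [h2] at this
  exact this

/-- EVERY graph on `3` vertices is a member (`thr 3 = 4 > 3`). [folklore] -/
theorem mem_of_size_three (G : SimpleGraph (Fin 3)) :
    (⟨3, G⟩ : Σ n, SimpleGraph (Fin n)) ∈ ramseySetAt thr := by
  have ht : thr 3 = 4 := by decide
  refine ⟨?_, ?_⟩ <;> simp only [ht] <;> exact SimpleGraph.cliqueFree_of_card_lt (by simp)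

/-- The complete graph on `n` vertices has a `k`-clique for every `k ≤ n`. [folklore] -/
theorem not_cliqueFree_top {n k : ℕ} (h : k ≤ n) : ¬ (⊤ : SimpleGraph (Fin n)).CliqueFree k := by
  have hc : (SimpleGraph.completeGraph (Fin k)).IsContained (SimpleGraph.completeGraph (Fin n)) :=
    (SimpleGraph.Embedding.completeGraph (Fin.castLEEmb h)).isContained
  simpa using hc.not_cliqueFree

/-- Complete graphs on `n ≥ 4` vertices are non-members. [folklore] -/
theorem top_not_mem {n : ℕ} (hn : 4 ≤ n) :
    (⟨n, ⊤⟩ : Σ n, SimpleGraph (Fin n)) ∉ ramseySetAt thr :=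
  fun h => not_cliqueFree_top (thr_le_self hn) h.1

/-! ## §1 A disproof is an NP-membership proof; the sandwich `coNP = NP ⟹ ¬crux`, `crux ⟹ coNP ≠ NP` -/

/-- `¬ RamseyNotNP` is literally `RAMSEY₂ ∈ NP`. [folklore] -/
theorem not_ramseyNotNP_iff : ¬ RamseyNotNP ↔ ramseyLangAt thr ∈ Nondeterministic.NP := not_not

/-- RAMSEY₂ ∈ coNP — the route's support item `RamseyInCoNP`, LANDED in the tree
(`Summit.PneNP.PneNP.Theorems.ramseyInCoNP_proof`). [folklore] -/
theorem ramseyLang_thr_mem_coNP : ramseyLangAt thr ∈ coNP :=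
  Summit.PneNP.PneNP.Theorems.ramseyInCoNP_proof

/-- **A collapse refutes the crux**: `coNP = NP → ¬ RamseyNotNP`. [folklore] -/
theorem not_ramseyNotNP_of_coNP_eq_NP (h : coNP = Nondeterministic.NP) : ¬ RamseyNotNP :=
  fun hX => hX (h ▸ ramseyLang_thr_mem_coNP)

/-- **The crux separates `coNP` from `NP`.** [folklore] -/
theorem coNP_ne_NP_of_ramseyNotNP (hX : RamseyNotNP) : coNP ≠ Nondeterministic.NP :=
  fun h => not_ramseyNotNP_of_coNP_eq_NP h hX

/-- **The crux separates `NP` from `P`** (`P = co P`, tree fact `co_P_holds`). [folklore] -/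
theorem NP_ne_P_of_ramseyNotNP (hX : RamseyNotNP) : Nondeterministic.NP ≠ Classes.P := by
  intro h
  apply coNP_ne_NP_of_ramseyNotNP hX
  show co Nondeterministic.NP = Nondeterministic.NP
  rw [h]
  exact co_P_holds

/-- If the summit fails then `coNP = P` (the bridges `P_bool_eq_holds`, `np_bool_eq`, `co_P_holds`).
[folklore] -/
theorem coNP_eq_P_of_not_pneNP (hne : ¬ PneNP) : coNP = Classes.P := by
  have hP : Literature.Computability.Complexity.PNPWave0.P Bool = Classes.P := P_bool_eq_holds
  have hN : Literature.Computability.Complexity.PNPWave0.NP Bool = Nondeterministic.NP := np_bool_eq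
  have hsub : Nondeterministic.NP ⊆ Classes.P := by
    intro L hL
    by_contra hL'
    exact hne ⟨L, hN ▸ hL, hP ▸ hL'⟩
  have heq : Nondeterministic.NP = Classes.P := Set.Subset.antisymm hsub P_subset_NP_holds
  show co Nondeterministic.NP = Classes.P
  rw [heq]
  exact co_P_holds

/-- **ROUTE NOTE — the weaker target suffices** (stated contrapositively: no summit conclusion in this
file).  If the summit fails then `RAMSEY₂ ∈ P`; i.e. already `RAMSEY₂ ∉ P` closes the summit through the
same assembly (`¬PneNP ⟹ NP = P ⟹ coNP = P ∋ RAMSEY₂`): the crux `RAMSEY₂ ∉ NP` is STRONGER than the summit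
needs by exactly the commitment `coNP ≠ NP`. [folklore] -/
theorem ramseyLang_thr_mem_P_of_not_pneNP (hne : ¬ PneNP) : ramseyLangAt thr ∈ Classes.P :=
  coNP_eq_P_of_not_pneNP hne ▸ ramseyLang_thr_mem_coNP

/-- The crux implies the weaker target (`P ⊆ NP`). [folklore] -/
theorem ramseyNotP_of_ramseyNotNP (hX : RamseyNotNP) : ramseyLangAt thr ∉ Classes.P :=
  fun h => hX (P_subset_NP_holds h)

/-- **The crux alone closes the summit** (the planner's `closes` fed with the landed support).
[folklore] -/
theorem pneNP_of_ramseyNotNP (hX : RamseyNotNP) : PneNP :=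
  Summit.PneNP.PneNP.Theses.RamseyUncertifiable.closes hX Summit.PneNP.PneNP.Theorems.ramseyInCoNP_proof

/-! ## §2 Load-bearing, threshold from below: finite Ramsey languages are in `P` -/

/-- Finite languages are in `P` (hard-wire the members: `FP` is closed under finite patching).
[folklore] -/
theorem mem_P_of_finite {S : Language Bool} (hS : (S : Set (List Bool)).Finite) : S ∈ Classes.P := by
  classical
  have hlen : ∀ x ∈ S, x.length < hS.toFinset.sup List.length + 1 := fun x hx =>
    Nat.lt_succ_of_le (Finset.le_sup (f := List.length) (hS.mem_toFinset.2 hx))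
  refine mem_P_of_mem_FP (g := fun x => if x ∈ S then [true] else [false]) ?_ S
    fun w => ⟨fun hw => if_pos hw, fun hw => if_neg hw⟩
  exact mem_FP_of_eqOn_le (const_mem_FP [false]) (hS.toFinset.sup List.length + 1)
    fun z hz => if_neg fun hzS => absurd (hlen z hzS) (not_lt.2 hz)

/-- Finite languages are in `NP`. [folklore] -/
theorem mem_NP_of_finite {S : Language Bool} (hS : (S : Set (List Bool)).Finite) :
    S ∈ Nondeterministic.NP :=
  P_subset_NP_holds (mem_P_of_finite hS)

/-- Graphs of bounded size form a finite set. [folklore] -/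
theorem finite_sizes_lt (N : ℕ) : {p : Σ n, SimpleGraph (Fin n) | p.1 < N}.Finite := by
  have h : {p : Σ n, SimpleGraph (Fin n) | p.1 < N} ⊆
      ⋃ n ∈ Finset.range N, Set.range (fun G : SimpleGraph (Fin n) => (⟨n, G⟩ : Σ m, SimpleGraph (Fin m))) := by
    rintro ⟨n, G⟩ hn
    simp only [Set.mem_setOf_eq] at hn
    simp only [Set.mem_iUnion, Set.mem_range, Finset.mem_range]
    exact ⟨n, hn, G, rfl⟩
  exact Set.Finite.subset (Set.Finite.biUnion (Finset.range N).finite_toSet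
    fun n _ => Set.finite_range _) h

/-- Complement commutes with pull-back along an injection. [folklore] -/
theorem compl_comap_eq {α β : Type*} (G : SimpleGraph β) (f : α ↪ β) :
    (G.comap f)ᶜ = Gᶜ.comap f := by
  ext a b
  simp [SimpleGraph.compl_adj]

/-- **Erdős–Szekeres transported to `n ≥ 4^k` vertices**: every graph on `n ≥ 4^k` vertices has a
`k`-clique or a `k`-independent set (tree fact `ramsey_diagonal_le_four_pow_holds` on the first `4^k`
vertices). [folklore] -/
theorem not_ramsey_of_fourPow_le {n k : ℕ} (h : 4 ^ k ≤ n) (G : SimpleGraph (Fin n)) :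
    ¬ (G.CliqueFree k ∧ Gᶜ.CliqueFree k) := by
  rintro ⟨hG, hGc⟩
  set f : Fin (4 ^ k) ↪ Fin n := Fin.castLEEmb h
  have hsub : (G.comap f).IsContained G := (SimpleGraph.Embedding.comap f G).isContained
  have hsubc : (Gᶜ.comap f).IsContained Gᶜ := (SimpleGraph.Embedding.comap f Gᶜ).isContained
  rcases Literature.Combinatorics.SimpleGraph.ramsey_diagonal_le_four_pow_holds k (G.comap f) with h1 | h2
  · exact h1 (hG.comap hsub)
  · rw [compl_comap_eq] at h2
    exact h2 (hGc.comap hsubc)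

/-- **LOAD-BEARING (threshold from below).** If `4^{k n} ≤ n` for all `n ≥ n₀`, the Ramsey set at
threshold `k` lives on fewer than `n₀` vertices. [folklore] -/
theorem ramseySetAt_subset_of_fourPow {k : ℕ → ℕ} {n₀ : ℕ} (hk : ∀ n ≥ n₀, 4 ^ k n ≤ n) :
    ramseySetAt k ⊆ {p | p.1 < n₀} := by
  rintro ⟨n, G⟩ hp
  by_contra hn
  simp only [Set.mem_setOf_eq, not_lt] at hn
  exact not_ramsey_of_fourPow_le (hk n hn) G hp

/-- … hence is finite. [folklore] -/
theorem ramseySetAt_finite_of_fourPow {k : ℕ → ℕ} {n₀ : ℕ} (hk : ∀ n ≥ n₀, 4 ^ k n ≤ n) :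
    (ramseySetAt k).Finite :=
  (finite_sizes_lt n₀).subset (ramseySetAt_subset_of_fourPow hk)

/-- A finite Ramsey set gives a finite language, which is in `NP`: the crux shape FAILS. [folklore] -/
theorem not_ramseyNotNPAt_of_finite {k : ℕ → ℕ} (h : (ramseySetAt k).Finite) : ¬ RamseyNotNPAt k :=
  fun hX => hX (mem_NP_of_finite (h.image _))

/-- **`¬ RamseyNotNPAt k` whenever `4^{k n} ≤ n` eventually** (Erdős–Szekeres kills the threshold).
[folklore] -/
theorem not_ramseyNotNPAt_of_fourPow {k : ℕ → ℕ} {n₀ : ℕ} (hk : ∀ n ≥ n₀, 4 ^ k n ≤ n) :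
    ¬ RamseyNotNPAt k :=
  not_ramseyNotNPAt_of_finite (ramseySetAt_finite_of_fourPow hk)

/-- Every CONSTANT threshold is refuted (`R(c,c) ≤ 4^c`). [folklore] -/
theorem not_ramseyNotNPAt_const (c : ℕ) : ¬ RamseyNotNPAt (fun _ => c) :=
  not_ramseyNotNPAt_of_fourPow (n₀ := 4 ^ c) fun _ hn => hn

/-- The threshold `⌊log₄ n⌋` is refuted. [folklore] -/
theorem not_ramseyNotNPAt_log_four : ¬ RamseyNotNPAt (fun n => Nat.log 4 n) :=
  not_ramseyNotNPAt_of_fourPow (n₀ := 1) fun n hn => Nat.pow_log_le_self 4 (by omega)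

/-- The threshold `⌊log₂ n⌋ / 2` ("`½ log₂ n`") is refuted: the constant `2` of the crux cannot be
lowered to `1/2`. [folklore] -/
theorem not_ramseyNotNPAt_half_log_two : ¬ RamseyNotNPAt (fun n => Nat.log 2 n / 2) := by
  refine not_ramseyNotNPAt_of_fourPow (n₀ := 1) fun n hn => ?_
  calc 4 ^ (Nat.log 2 n / 2) = 2 ^ (2 * (Nat.log 2 n / 2)) := by rw [pow_mul]; norm_num
    _ ≤ 2 ^ Nat.log 2 n := Nat.pow_le_pow_right (by norm_num) (Nat.mul_div_le _ _)
    _ ≤ n := Nat.pow_log_le_self 2 (by omega)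

/-! ## §3 Load-bearing, threshold from above: the trivial threshold gives the code-word language -/

/-- If `n < k n` for all `n`, every graph is "Ramsey" at threshold `k`. [folklore] -/
theorem ramseySetAt_eq_univ_of_lt {k : ℕ → ℕ} (hk : ∀ n, n < k n) : ramseySetAt k = Set.univ := by
  refine Set.eq_univ_of_forall fun ⟨n, G⟩ => ⟨?_, ?_⟩ <;>
    exact SimpleGraph.cliqueFree_of_card_lt (by simpa using hk n)

/-- The set of graph code words is `HamNP.gcodeLang`, hence in `P`. [folklore] -/
theorem range_encode_eq_gcodeLang :
    (Set.range encodingGraph.encode : Language Bool) = HamNP.gcodeLang := by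
  refine Set.ext fun x => ⟨?_, fun hx => ?_⟩
  · rintro ⟨⟨n, G⟩, rfl⟩
    exact (HamNP.mem_gcodeLang_iff _).2 ⟨n, G, rfl⟩
  · obtain ⟨n, G, rfl⟩ := (HamNP.mem_gcodeLang_iff x).1 hx
    exact ⟨⟨n, G⟩, rfl⟩

/-- Graph code words form a `P` language. [folklore] -/
theorem range_encode_mem_P : (Set.range encodingGraph.encode : Language Bool) ∈ Classes.P :=
  range_encode_eq_gcodeLang ▸ HamNP.gcodeLang_mem_P

/-- **LOAD-BEARING (threshold from above).** `¬ RamseyNotNPAt k` whenever `n < k n` for all `n`: the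
language is the code-word language. [folklore] -/
theorem not_ramseyNotNPAt_of_lt {k : ℕ → ℕ} (hk : ∀ n, n < k n) : ¬ RamseyNotNPAt k := by
  intro hX
  apply hX
  have : ramseyLangAt k = Set.range encodingGraph.encode := by
    rw [ramseyLangAt, ramseySetAt_eq_univ_of_lt hk, Encoding.toLanguage, Set.image_univ]
  rw [this]
  exact P_subset_NP_holds range_encode_mem_P

/-! ## §4 Only the eventual behaviour of the threshold matters -/

/-- **`NP` is closed under finite modification**: if `L ∈ NP` and `L'` differs from `L` on a finite set,
then `L' ∈ NP` (`L' = (F₁ ⊔ L) ⊓ F₂ᶜ` with `F₁ = L' \ L`, `F₂ = L \ L'` finite, hence in `P`).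
[folklore] -/
theorem mem_NP_of_finite_modification {L L' : Language Bool} (hL : L ∈ Nondeterministic.NP)
    (h₁ : (L' \ L : Set (List Bool)).Finite) (h₂ : (L \ L' : Set (List Bool)).Finite) :
    L' ∈ Nondeterministic.NP := by
  have heq : L' = ((L \ L' : Set (List Bool)) : Language Bool)ᶜ ⊓ (((L' \ L : Set (List Bool)) : Language Bool) ⊔ L) := by
    ext x
    change x ∈ L' ↔ ¬ (x ∈ L ∧ x ∉ L') ∧ ((x ∈ L' ∧ x ∉ L) ∨ x ∈ L)
    tauto
  rw [heq]
  refine inter_P_mem_polyExists (K := Classes.P) (fun _ _ a b => inter_mem_P a b)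
    (compl_mem_P_iff.2 (mem_P_of_finite h₂)) ?_
  exact union_P_mem_polyExists (K := Classes.P) (fun _ _ a b => union_mem_P a b) (mem_P_of_finite h₁) hL

/-- Two thresholds that eventually agree define languages with finite symmetric difference. [folklore] -/
theorem ramseyLangAt_diff_finite {k k' : ℕ → ℕ} {n₀ : ℕ} (h : ∀ n ≥ n₀, k n = k' n) :
    (ramseyLangAt k \ ramseyLangAt k' : Set (List Bool)).Finite := by
  have hsub : (ramseyLangAt k \ ramseyLangAt k' : Set (List Bool)) ⊆
      encodingGraph.encode '' {p : Σ n, SimpleGraph (Fin n) | p.1 < n₀} := by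
    rintro x ⟨⟨p, hp, rfl⟩, hx⟩
    refine ⟨p, ?_, rfl⟩
    simp only [Set.mem_setOf_eq]
    by_contra hn
    apply hx
    refine ⟨p, ?_, rfl⟩
    have e := h p.1 (not_lt.1 hn)
    simp only [ramseySetAt, Set.mem_setOf_eq] at hp ⊢
    rw [← e]
    exact hp
  exact ((finite_sizes_lt n₀).image _).subset hsub

/-- **Eventual invariance.** If `k n = k' n` for all `n ≥ n₀` then `RamseyNotNPAt k ↔ RamseyNotNPAt k'`.
[folklore] -/
theorem ramseyNotNPAt_congr {k k' : ℕ → ℕ} {n₀ : ℕ} (h : ∀ n ≥ n₀, k n = k' n) :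
    RamseyNotNPAt k ↔ RamseyNotNPAt k' := by
  have h' : ∀ n ≥ n₀, k' n = k n := fun n hn => (h n hn).symm
  exact not_congr ⟨fun hk => mem_NP_of_finite_modification hk (ramseyLangAt_diff_finite h')
      (ramseyLangAt_diff_finite h),
    fun hk' => mem_NP_of_finite_modification hk' (ramseyLangAt_diff_finite h)
      (ramseyLangAt_diff_finite h')⟩

/-- Eventual form of §3: `n < k n` for all LARGE `n` already refutes the threshold. [folklore] -/
theorem not_ramseyNotNPAt_of_eventually_lt {k : ℕ → ℕ} {n₀ : ℕ} (hk : ∀ n ≥ n₀, n < k n) :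
    ¬ RamseyNotNPAt k := by
  rw [ramseyNotNPAt_congr (k' := fun n => if n₀ ≤ n then k n else n + 1) (n₀ := n₀)
    (fun n hn => by simp [hn])]
  refine not_ramseyNotNPAt_of_lt fun n => ?_
  by_cases hn : n₀ ≤ n
  · simpa [hn] using hk n hn
  · simp [hn]

/-! ## §5 Necessary conditions: an NP-outsider is infinite and co-infinite among code words — both hold -/

/-- If `RAMSEY_k ∉ NP` then the language is infinite. [folklore] -/
theorem infinite_of_ramseyNotNPAt {k : ℕ → ℕ} (h : RamseyNotNPAt k) : (ramseyLangAt k : Set (List Bool)).Infinite :=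
  fun hfin => h (mem_NP_of_finite hfin)

/-- If `RAMSEY_k ∉ NP` then infinitely many code words lie outside the language. [folklore] -/
theorem coinfinite_of_ramseyNotNPAt {k : ℕ → ℕ} (h : RamseyNotNPAt k) :
    (Set.range encodingGraph.encode \ ramseyLangAt k : Set (List Bool)).Infinite := by
  intro hfin
  apply h
  have heq : ramseyLangAt k = (Set.range encodingGraph.encode : Language Bool) ⊓
      ((Set.range encodingGraph.encode \ ramseyLangAt k : Set (List Bool)) : Language Bool)ᶜ := by
    ext x
    change x ∈ ramseyLangAt k ↔ x ∈ Set.range encodingGraph.encode ∧ ¬ (x ∈ Set.range encodingGraph.encode ∧ x ∉ ramseyLangAt k)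
    constructor
    · intro hx
      refine ⟨?_, fun h' => h'.2 hx⟩
      obtain ⟨p, -, rfl⟩ := hx
      exact ⟨p, rfl⟩
    · rintro ⟨hx, h'⟩
      by_contra hx'
      exact h' ⟨hx, hx'⟩
  rw [heq]
  exact P_subset_NP_holds (inter_mem_P range_encode_mem_P (compl_mem_P_iff.2 (mem_P_of_finite hfin)))

/-- **Co-infinitude at the crux threshold**: the codes of `K_n`, `n ≥ 4`, lie outside. [folklore] -/
theorem ramseyLang_thr_coinfinite :
    (Set.range encodingGraph.encode \ ramseyLangAt thr : Set (List Bool)).Infinite := by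
  have hinj : Function.Injective fun m : ℕ => encodingGraph.encode ⟨m + 4, (⊤ : SimpleGraph (Fin (m + 4)))⟩ := by
    intro a b hab
    have := congrArg Sigma.fst (encodingGraph.encode_injective hab)
    simpa using this
  refine Set.infinite_of_injective_forall_mem hinj fun m => ⟨⟨_, rfl⟩, fun hm => ?_⟩
  have hm' := (Encoding.mem_toLanguage_iff _ _ _).1 hm
  exact top_not_mem (by omega) hm'

/-- The Erdős union bound at dyadic sizes: `C(2^m, 2m) · 2^{1 - C(2m, 2)} < 1` for `m ≥ 2`
(`≤ 2^{m+1}/(2m)!`). [folklore] -/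
theorem erdos_bound_two_pow {m : ℕ} (hm : 2 ≤ m) :
    ((2 ^ m).choose (2 * m) : ℝ) * (2 : ℝ) ^ ((1 : ℝ) - ((2 * m).choose 2 : ℝ)) < 1 := by
  -- the factorial beats the power: 2^{m+1} < (2m)!
  have hfact : ∀ m, 2 ≤ m → 2 ^ (m + 1) < (2 * m).factorial := by
    intro m hm
    induction m, hm using Nat.le_induction with
    | base => decide
    | succ m hm ih =>
      have e : (2 * (m + 1)).factorial = (2 * m + 2) * ((2 * m + 1) * (2 * m).factorial) := by
        rw [show 2 * (m + 1) = (2 * m + 1) + 1 by ring, Nat.factorial_succ, Nat.factorial_succ]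
      rw [e, pow_succ]
      calc 2 ^ (m + 1) * 2 < (2 * m).factorial * 2 := by linarith
        _ = 2 * (2 * m).factorial := mul_comm _ _
        _ ≤ (2 * m + 2) * ((2 * m + 1) * (2 * m).factorial) :=
          Nat.mul_le_mul (by omega) (Nat.le_mul_of_pos_left _ (by omega))
  -- exponent bookkeeping: (2^m)^(2m) · 2 = 2^(m+1) · 2^(C(2m,2))
  have hexp : m * (2 * m) + 1 = (m + 1) + (2 * m).choose 2 := by
    rw [Nat.choose_two_right]
    obtain ⟨m', rfl⟩ : ∃ m', m = m' + 1 := ⟨m - 1, by omega⟩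
    have : 2 * (m' + 1) * (2 * (m' + 1) - 1) / 2 = (m' + 1) * (2 * m' + 1) := by
      rw [show 2 * (m' + 1) * (2 * (m' + 1) - 1) = 2 * ((m' + 1) * (2 * m' + 1)) by
        rw [show 2 * (m' + 1) - 1 = 2 * m' + 1 by omega]; ring]
      simp
    rw [this]; ring
  have hchoose : ((2 ^ m).choose (2 * m) : ℝ) ≤ ((2 : ℝ) ^ m) ^ (2 * m) / (2 * m).factorial := by
    have := Nat.choose_le_pow_div (2 * m) (2 ^ m) (α := ℝ)
    push_cast at this
    exact this
  have hrpow : (2 : ℝ) ^ ((1 : ℝ) - ((2 * m).choose 2 : ℝ)) = 2 / (2 : ℝ) ^ ((2 * m).choose 2) := by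
    rw [Real.rpow_sub two_pos, Real.rpow_one, Real.rpow_natCast]
  rw [hrpow]
  have hpos : (0 : ℝ) < (2 * m).factorial := by exact_mod_cast Nat.factorial_pos _
  have hpow : (0 : ℝ) < (2 : ℝ) ^ ((2 * m).choose 2) := by positivity
  calc ((2 ^ m).choose (2 * m) : ℝ) * (2 / (2 : ℝ) ^ ((2 * m).choose 2))
      ≤ ((2 : ℝ) ^ m) ^ (2 * m) / (2 * m).factorial * (2 / (2 : ℝ) ^ ((2 * m).choose 2)) :=
        mul_le_mul_of_nonneg_right hchoose (by positivity)
    _ = (2 : ℝ) ^ (m + 1) / (2 * m).factorial := by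
        rw [div_mul_div_comm, ← pow_mul, ← pow_succ, hexp, pow_add,
          mul_div_mul_right _ _ (ne_of_gt hpow)]
    _ < 1 := by
        rw [div_lt_one hpos]
        exact_mod_cast hfact m hm

/-- **Erdős 1947 at dyadic sizes**: for `m ≥ 2` some graph on `2^m` vertices is a member of the crux set
(threshold `thr (2^m) = 2m`). [folklore] -/
theorem exists_mem_two_pow {m : ℕ} (hm : 2 ≤ m) :
    ∃ G : SimpleGraph (Fin (2 ^ m)), (⟨2 ^ m, G⟩ : Σ n, SimpleGraph (Fin n)) ∈ ramseySetAt thr := by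
  obtain ⟨G, hG⟩ := Literature.Combinatorics.SimpleGraph.erdos1947_ramsey_lower_holds (2 ^ m) (2 * m)
    (erdos_bound_two_pow hm)
  refine ⟨G, ?_⟩
  show G.CliqueFree (thr (2 ^ m)) ∧ Gᶜ.CliqueFree (thr (2 ^ m))
  rw [thr_two_pow]
  exact hG

/-- **The crux set is infinite** (so `RamseyNotNP` is not refutable by finiteness). [folklore] -/
theorem ramseySetAt_thr_infinite : (ramseySetAt thr).Infinite := by
  choose G hG using fun m : ℕ => exists_mem_two_pow (m := m + 2) (by omega)
  have hinj : Function.Injective fun m : ℕ => (⟨2 ^ (m + 2), G m⟩ : Σ n, SimpleGraph (Fin n)) := by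
    intro a b hab
    have h1 : 2 ^ (a + 2) = 2 ^ (b + 2) := congrArg Sigma.fst hab
    have := Nat.pow_right_injective le_rfl h1
    omega
  exact Set.infinite_of_injective_forall_mem hinj hG

/-- **The crux language is infinite.** [folklore] -/
theorem ramseyLang_thr_infinite : (ramseyLangAt thr : Set (List Bool)).Infinite :=
  ramseySetAt_thr_infinite.image encodingGraph.encode_injective.injOn

/-! ## §6 Strengthenings refuted -/

/-- The strengthening "RAMSEY₂ ∉ coNP" is FALSE (landed support). [folklore] -/
theorem not_ramseyNotCoNP : ¬ (ramseyLangAt thr ∉ coNP) := fun h => h ramseyLang_thr_mem_coNP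

/-- The universal closure of the crux shape over thresholds is FALSE (already the constant threshold `0`
gives the empty language). [folklore] -/
theorem not_forall_threshold : ¬ ∀ k : ℕ → ℕ, RamseyNotNPAt k := fun h => not_ramseyNotNPAt_const 0 (h _)


/-! ## §7 Instance form of the crux and the immunity-type strengthenings -/

/-- **Instance form.** `RAMSEY_k ∉ NP` iff EVERY `NP` language made of (codes of) `k`-Ramsey graphs misses
infinitely many of them — "no sound NP proof system for Ramsey-ness is complete up to finitely many
exceptions".  (`→`: finite modification, §4; `←`: take the language itself.) [folklore] -/
theorem ramseyNotNPAt_iff_forall_NP_misses_infinite {k : ℕ → ℕ} :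
    RamseyNotNPAt k ↔ ∀ L ∈ Nondeterministic.NP, L ≤ ramseyLangAt k →
      ((ramseyLangAt k : Set (List Bool)) \ L).Infinite := by
  constructor
  · intro hX L hL hsub hfin
    refine hX (mem_NP_of_finite_modification hL hfin ?_)
    refine Set.Finite.subset Set.finite_empty ?_
    rintro x ⟨hxL, hxR⟩
    exact (hxR (hsub hxL)).elim
  · intro h hX
    refine h _ hX le_rfl (Set.finite_empty.subset ?_)
    rintro x ⟨hx, hx'⟩
    exact (hx' hx).elim

/-- `NP`-IMMUNITY of `RAMSEY_k` (the "every certifiable family is finite" strengthening): the language is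
infinite and has no infinite `NP` subset. [folklore] -/
def RamseyNPImmuneAt (k : ℕ → ℕ) : Prop :=
  (ramseyLangAt k : Set (List Bool)).Infinite ∧
    ∀ L ∈ Nondeterministic.NP, L ≤ ramseyLangAt k → (L : Set (List Bool)).Finite

/-- `P`-IMMUNITY of `RAMSEY_k`: no infinite `P` subset — equivalently (for the crux threshold) NO
polynomial-time-printable infinite family of `⌈2log₂ n⌉`-Ramsey graphs, i.e. the negation of Erdős'
explicit-construction problem at the sharp threshold (explicit constructions reach `(log n)^{O(1)}` only).
[folklore] -/
def RamseyPImmuneAt (k : ℕ → ℕ) : Prop :=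
  (ramseyLangAt k : Set (List Bool)).Infinite ∧
    ∀ L ∈ Classes.P, L ≤ ramseyLangAt k → (L : Set (List Bool)).Finite

/-- Immunity implies the crux shape (strictly stronger in spirit: it forbids even one explicit certified
family). [folklore] -/
theorem ramseyNotNPAt_of_NPImmune {k : ℕ → ℕ} (h : RamseyNPImmuneAt k) : RamseyNotNPAt k :=
  fun hX => h.1 (h.2 _ hX le_rfl)

/-- `NP`-immunity implies `P`-immunity. [folklore] -/
theorem PImmune_of_NPImmune {k : ℕ → ℕ} (h : RamseyNPImmuneAt k) : RamseyPImmuneAt k :=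
  ⟨h.1, fun L hL hsub => h.2 L (P_subset_NP_holds hL) hsub⟩

/-- Immunity FAILS at every threshold refuted in §2 (finite language). [folklore] -/
theorem not_NPImmune_of_fourPow {k : ℕ → ℕ} {n₀ : ℕ} (hk : ∀ n ≥ n₀, 4 ^ k n ≤ n) :
    ¬ RamseyNPImmuneAt k :=
  fun h => h.1 ((ramseySetAt_finite_of_fourPow hk).image _)

/-- Immunity FAILS at the trivial thresholds of §3 (the whole code-word language is a `P` subset).
[folklore] -/
theorem not_PImmune_of_lt {k : ℕ → ℕ} (hk : ∀ n, n < k n) : ¬ RamseyPImmuneAt k := by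
  rintro ⟨hinf, h⟩
  have e : ramseyLangAt k = Set.range encodingGraph.encode := by
    rw [ramseyLangAt, ramseySetAt_eq_univ_of_lt hk, Encoding.toLanguage, Set.image_univ]
  refine hinf (h _ ?_ le_rfl)
  rw [e]
  exact range_encode_mem_P

/-! ## §8 `NP` is closed under intersection; the one-sided consequence of the crux -/

/-- **`NP` is closed under binary intersection** (concatenate the two witnesses as a pair; the verifier
projects and re-checks both length bounds, `LenLe`). [folklore] -/
theorem inter_mem_NP {L₁ L₂ : Language Bool} (h₁ : L₁ ∈ Nondeterministic.NP)
    (h₂ : L₂ ∈ Nondeterministic.NP) : L₁ ⊓ L₂ ∈ Nondeterministic.NP := by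
  obtain ⟨V₁, hV₁, q₁, hq₁⟩ := h₁
  obtain ⟨V₂, hV₂, q₂, hq₂⟩ := h₂
  -- projections of `w = ⟨x, ⟨y₁, y₂⟩⟩` to `⟨x, y₁⟩` and `⟨x, y₂⟩`
  set π₁ : List Bool → List Bool := fanoutFn Brick.fstF (Brick.fstF ∘ Brick.sndF) with hπ₁def
  set π₂ : List Bool → List Bool := fanoutFn Brick.fstF (Brick.sndF ∘ Brick.sndF) with hπ₂def
  have hπ₁ : π₁ ∈ FP :=
    fanoutFn_mem_FP Brick.fstF_mem_FP (comp_mem_FP Brick.fstF_mem_FP Brick.sndF_mem_FP)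
  have hπ₂ : π₂ ∈ FP :=
    fanoutFn_mem_FP Brick.fstF_mem_FP (comp_mem_FP Brick.sndF_mem_FP Brick.sndF_mem_FP)
  have e₁ : ∀ x y, π₁ (boolPair x y) = boolPair x (Brick.fstF y) := fun x y => by simp [hπ₁def]
  have e₂ : ∀ x y, π₂ (boolPair x y) = boolPair x (Brick.sndF y) := fun x y => by simp [hπ₂def]
  refine ⟨(π₁ ⁻¹' (LenLe q₁ ⊓ V₁) : Language Bool) ⊓ (π₂ ⁻¹' (LenLe q₂ ⊓ V₂) : Language Bool),
    inter_mem_P (preimage_mem_P (inter_mem_P (LenLe_mem_P q₁) hV₁) hπ₁)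
      (preimage_mem_P (inter_mem_P (LenLe_mem_P q₂) hV₂) hπ₂), 2 * q₁ + 2 + q₂, fun x => ?_⟩
  have heval : ∀ n, (2 * q₁ + 2 + q₂ : Polynomial ℕ).eval n = 2 * q₁.eval n + 2 + q₂.eval n := by
    intro n; simp [Polynomial.eval_add, Polynomial.eval_mul]
  change x ∈ L₁ ∧ x ∈ L₂ ↔ ∃ y, y.length ≤ (2 * q₁ + 2 + q₂ : Polynomial ℕ).eval x.length ∧
    (π₁ (boolPair x y) ∈ LenLe q₁ ∧ π₁ (boolPair x y) ∈ V₁) ∧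
      (π₂ (boolPair x y) ∈ LenLe q₂ ∧ π₂ (boolPair x y) ∈ V₂)
  simp only [heval, e₁, e₂, boolPair_mem_LenLe]
  constructor
  · rintro ⟨hx₁, hx₂⟩
    obtain ⟨y₁, hy₁, hw₁⟩ := (hq₁ x).1 hx₁
    obtain ⟨y₂, hy₂, hw₂⟩ := (hq₂ x).1 hx₂
    refine ⟨boolPair y₁ y₂, ?_, ?_, ?_⟩
    · rw [length_boolPair]; omega
    · simpa using And.intro hy₁ hw₁
    · simpa using And.intro hy₂ hw₂
  · rintro ⟨y, -, ⟨hl₁, hw₁⟩, ⟨hl₂, hw₂⟩⟩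
    exact ⟨(hq₁ x).2 ⟨_, hl₁, hw₁⟩, (hq₂ x).2 ⟨_, hl₂, hw₂⟩⟩

/-- The one-sided languages: no `k n`-clique, resp. no `k n`-independent set. [folklore] -/
def cliqueFreeLangAt (k : ℕ → ℕ) : Language Bool :=
  encodingGraph.toLanguage {p : Σ n, SimpleGraph (Fin n) | p.2.CliqueFree (k p.1)}

/-- (second one-sided language) [folklore] -/
def indepFreeLangAt (k : ℕ → ℕ) : Language Bool :=
  encodingGraph.toLanguage {p : Σ n, SimpleGraph (Fin n) | p.2ᶜ.CliqueFree (k p.1)}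

/-- `RAMSEY_k = CLIQUEFREE_k ∩ INDEPFREE_k` (images of an injective code). [folklore] -/
theorem ramseyLangAt_eq_inter (k : ℕ → ℕ) :
    ramseyLangAt k = cliqueFreeLangAt k ⊓ indepFreeLangAt k := by
  change encodingGraph.encode '' _ = encodingGraph.encode '' _ ∩ encodingGraph.encode '' _
  rw [← Set.image_inter encodingGraph.encode_injective]
  rfl

/-- **One-sided consequence of the crux.** `RAMSEY_k ∉ NP` forces `CLIQUEFREE_k ∉ NP` or
`INDEPFREE_k ∉ NP`: proving the crux entails that "no `⌈2log₂ n⌉`-clique" (or its complement twin) has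
no polynomial certificates either — the crux is at least as strong as the one-sided `coCLIQUE_{2log₂ n} ∉ NP`
disjunction, while the route's SoS mechanism (`las(G)·las(Ḡ) ≥ n^δ`) speaks only to the two-sided
language. [folklore] -/
theorem oneSided_of_ramseyNotNPAt {k : ℕ → ℕ} (h : RamseyNotNPAt k) :
    cliqueFreeLangAt k ∉ Nondeterministic.NP ∨ indepFreeLangAt k ∉ Nondeterministic.NP := by
  by_contra hc
  push Not at hc
  apply h
  show ramseyLangAt k ∈ Nondeterministic.NP
  rw [ramseyLangAt_eq_inter]
  exact inter_mem_NP hc.1 hc.2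


/-! ## §9 Complement symmetry on codes: `CLIQUEFREE_k ∈ NP ↔ INDEPFREE_k ∈ NP`, so the crux forces each -/

/-- Complementation on the fields `(n, bits)` of a graph code: flip every bit off the diagonal, clear the
diagonal. [folklore] -/
def complBits (q : ℕ × List Bool) : ℕ × List Bool :=
  (q.1, (List.range q.2.length).map fun t => (!q.2.getD t false) && !decide (t / q.1 = t % q.1))

/-- **`complBits` is computed on codes in polynomial time** (typed `CodeFP` calculus: bit access by a
binary index, `natDiv`/`natMod`, a `map` over `range |bits|`, `bitsToStr`). [folklore] -/
theorem complBits_codeFP :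
    CodeFP (CodeFP.pairE CodeFP.natE CodeFP.strE) (CodeFP.pairE CodeFP.natE CodeFP.strE) complBits := by
  have hn : CodeFP (CodeFP.pairE CodeFP.natE CodeFP.strE) CodeFP.natE (fun q : ℕ × List Bool => q.1) :=
    CodeFP.fst _ _
  have hbits : CodeFP (CodeFP.pairE CodeFP.natE CodeFP.strE) CodeFP.strE (fun q : ℕ × List Bool => q.2) :=
    CodeFP.snd _ _
  have hrange : CodeFP (CodeFP.pairE CodeFP.natE CodeFP.strE) (CodeFP.rawE CodeFP.natE)
      (fun q : ℕ × List Bool => List.range q.2.length) :=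
    CodeFP.urange.comp (CodeFP.strLength.comp hbits)
  have gn : CodeFP (CodeFP.pairE (CodeFP.pairE CodeFP.natE CodeFP.strE) CodeFP.natE) CodeFP.natE
      (fun r : (ℕ × List Bool) × ℕ => r.1.1) := hn.comp (CodeFP.fst _ _)
  have gbits : CodeFP (CodeFP.pairE (CodeFP.pairE CodeFP.natE CodeFP.strE) CodeFP.natE) CodeFP.strE
      (fun r : (ℕ × List Bool) × ℕ => r.1.2) := hbits.comp (CodeFP.fst _ _)
  have gt : CodeFP (CodeFP.pairE (CodeFP.pairE CodeFP.natE CodeFP.strE) CodeFP.natE) CodeFP.natE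
      (fun r : (ℕ × List Bool) × ℕ => r.2) := CodeFP.snd _ _
  have gb : CodeFP (CodeFP.pairE (CodeFP.pairE CodeFP.natE CodeFP.strE) CodeFP.natE) CodeFP.bitE
      (fun r : (ℕ × List Bool) × ℕ => r.1.2.getD r.2 false) :=
    CodeFP.strGetDNat.comp (gbits.pair gt)
  have gd : CodeFP (CodeFP.pairE (CodeFP.pairE CodeFP.natE CodeFP.strE) CodeFP.natE) CodeFP.bitE
      (fun r : (ℕ × List Bool) × ℕ => decide (r.2 / r.1.1 = r.2 % r.1.1)) :=
    CodeFP.natEq.comp ((CodeFP.natDiv.comp (gt.pair gn)).pair (CodeFP.natMod.comp (gt.pair gn)))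
  have gp : CodeFP (CodeFP.pairE (CodeFP.pairE CodeFP.natE CodeFP.strE) CodeFP.natE) CodeFP.bitE
      (fun r : (ℕ × List Bool) × ℕ => (!r.1.2.getD r.2 false) && !decide (r.2 / r.1.1 = r.2 % r.1.1)) :=
    gb.not.and gd.not
  have hmap : CodeFP (CodeFP.pairE CodeFP.natE CodeFP.strE) (CodeFP.rawE CodeFP.bitE)
      (fun q : ℕ × List Bool =>
        (List.range q.2.length).map fun t => (!q.2.getD t false) && !decide (t / q.1 = t % q.1)) :=
    (CodeFP.map gp).comp ((CodeFP.id _).pair hrange)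
  exact hn.pair (CodeFP.bitsToStr.comp hmap)

/-- `complBits` sends the adjacency bits of `G` to those of `Gᶜ`. [folklore] -/
theorem complBits_adjBits (n : ℕ) (G : SimpleGraph (Fin n)) :
    complBits (n, CliqueNP.adjBits n G) = (n, CliqueNP.adjBits n Gᶜ) := by
  refine Prod.ext rfl ?_
  simp only [complBits, CliqueNP.length_adjBits]
  refine List.ext_getElem (by simp) fun t h1 h2 => ?_
  have ht : t < n * n := by simpa using h2
  rw [List.getElem_map, List.getElem_range, ← List.getD_eq_getElem _ false h2,
    CliqueNP.getD_adjBits Gᶜ ht, CliqueNP.getD_adjBits G ht]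
  rw [Bool.eq_iff_iff]
  simp only [Bool.and_eq_true, Bool.not_eq_true', decide_eq_false_iff_not, decide_eq_true_eq,
    SimpleGraph.compl_adj, ne_eq, Fin.mk.injEq]
  tauto

/-- **The complement map on graph codes is in `FP`**: some `f ∈ FP` has `f (code G) = code Gᶜ`.
[folklore] -/
theorem exists_complFn : ∃ f ∈ FP, ∀ (n : ℕ) (G : SimpleGraph (Fin n)),
    f (encodingGraph.encode ⟨n, G⟩) = encodingGraph.encode ⟨n, Gᶜ⟩ := by
  obtain ⟨f, hf, hspec⟩ := complBits_codeFP
  refine ⟨f, hf, fun n G => ?_⟩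
  have h := hspec (n, CliqueNP.adjBits n G)
  rw [complBits_adjBits] at h
  rw [HamNP.encode_eq, HamNP.encode_eq]
  exact h

/-- `INDEPFREE_k` is the pull-back of `CLIQUEFREE_k` along the complement map, cut down to code words.
[folklore] -/
theorem indepFreeLangAt_eq (k : ℕ → ℕ) {f : List Bool → List Bool}
    (hf : ∀ (n : ℕ) (G : SimpleGraph (Fin n)), f (encodingGraph.encode ⟨n, G⟩) = encodingGraph.encode ⟨n, Gᶜ⟩) :
    indepFreeLangAt k = HamNP.gcodeLang ⊓ (f ⁻¹' cliqueFreeLangAt k : Language Bool) := by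
  refine Set.ext fun x => ⟨?_, ?_⟩
  · rintro ⟨⟨n, G⟩, hG, rfl⟩
    refine ⟨(HamNP.mem_gcodeLang_iff _).2 ⟨n, G, rfl⟩, ?_⟩
    show f (encodingGraph.encode ⟨n, G⟩) ∈ cliqueFreeLangAt k
    rw [hf]
    exact (Encoding.mem_toLanguage_iff _ _ _).2 hG
  · rintro ⟨hx, hfx⟩
    obtain ⟨n, G, rfl⟩ := (HamNP.mem_gcodeLang_iff x).1 hx
    have hfx' : f (encodingGraph.encode ⟨n, G⟩) ∈ cliqueFreeLangAt k := hfx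
    rw [hf] at hfx'
    have hG := (Encoding.mem_toLanguage_iff _ _ _).1 hfx'
    exact ⟨⟨n, G⟩, hG, rfl⟩

/-- … and symmetrically. [folklore] -/
theorem cliqueFreeLangAt_eq (k : ℕ → ℕ) {f : List Bool → List Bool}
    (hf : ∀ (n : ℕ) (G : SimpleGraph (Fin n)), f (encodingGraph.encode ⟨n, G⟩) = encodingGraph.encode ⟨n, Gᶜ⟩) :
    cliqueFreeLangAt k = HamNP.gcodeLang ⊓ (f ⁻¹' indepFreeLangAt k : Language Bool) := by
  refine Set.ext fun x => ⟨?_, ?_⟩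
  · rintro ⟨⟨n, G⟩, hG, rfl⟩
    refine ⟨(HamNP.mem_gcodeLang_iff _).2 ⟨n, G, rfl⟩, ?_⟩
    show f (encodingGraph.encode ⟨n, G⟩) ∈ indepFreeLangAt k
    rw [hf]
    refine (Encoding.mem_toLanguage_iff _ _ _).2 ?_
    show Gᶜᶜ.CliqueFree (k n)
    rw [compl_compl]
    exact hG
  · rintro ⟨hx, hfx⟩
    obtain ⟨n, G, rfl⟩ := (HamNP.mem_gcodeLang_iff x).1 hx
    have hfx' : f (encodingGraph.encode ⟨n, G⟩) ∈ indepFreeLangAt k := hfx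
    rw [hf] at hfx'
    have hG : Gᶜᶜ.CliqueFree (k n) := (Encoding.mem_toLanguage_iff _ _ _).1 hfx'
    rw [compl_compl] at hG
    exact ⟨⟨n, G⟩, hG, rfl⟩

/-- **Complement symmetry**: `CLIQUEFREE_k ∈ NP ↔ INDEPFREE_k ∈ NP`. [folklore] -/
theorem cliqueFree_mem_NP_iff (k : ℕ → ℕ) :
    cliqueFreeLangAt k ∈ Nondeterministic.NP ↔ indepFreeLangAt k ∈ Nondeterministic.NP := by
  obtain ⟨f, hf, hspec⟩ := exists_complFn
  constructor
  · intro h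
    rw [indepFreeLangAt_eq k hspec]
    exact inter_P_mem_polyExists (K := Classes.P) (fun _ _ a b => inter_mem_P a b) HamNP.gcodeLang_mem_P
      (preimage_mem_NP h hf)
  · intro h
    rw [cliqueFreeLangAt_eq k hspec]
    exact inter_P_mem_polyExists (K := Classes.P) (fun _ _ a b => inter_mem_P a b) HamNP.gcodeLang_mem_P
      (preimage_mem_NP h hf)

/-- **Complement symmetry in `P`**: `CLIQUEFREE_k ∈ P ↔ INDEPFREE_k ∈ P`. [folklore] -/
theorem cliqueFree_mem_P_iff (k : ℕ → ℕ) :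
    cliqueFreeLangAt k ∈ Classes.P ↔ indepFreeLangAt k ∈ Classes.P := by
  obtain ⟨f, hf, hspec⟩ := exists_complFn
  constructor
  · intro h
    rw [indepFreeLangAt_eq k hspec]
    exact inter_mem_P HamNP.gcodeLang_mem_P (preimage_mem_P h hf)
  · intro h
    rw [cliqueFreeLangAt_eq k hspec]
    exact inter_mem_P HamNP.gcodeLang_mem_P (preimage_mem_P h hf)

/-- **The crux forces the one-sided statement**: `RAMSEY_k ∉ NP → CLIQUEFREE_k ∉ NP`. [folklore] -/
theorem cliqueFree_not_mem_NP_of_ramseyNotNPAt {k : ℕ → ℕ} (h : RamseyNotNPAt k) :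
    cliqueFreeLangAt k ∉ Nondeterministic.NP := fun hc =>
  (oneSided_of_ramseyNotNPAt h).elim (fun h' => h' hc) fun h' => h' ((cliqueFree_mem_NP_iff k).1 hc)

/-- … and `RAMSEY_k ∉ NP → INDEPFREE_k ∉ NP`. [folklore] -/
theorem indepFree_not_mem_NP_of_ramseyNotNPAt {k : ℕ → ℕ} (h : RamseyNotNPAt k) :
    indepFreeLangAt k ∉ Nondeterministic.NP := fun hc =>
  cliqueFree_not_mem_NP_of_ramseyNotNPAt h ((cliqueFree_mem_NP_iff k).2 hc)

/-- `RAMSEY_k ∉ P → CLIQUEFREE_k ∉ P`. [folklore] -/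
theorem cliqueFree_not_mem_P_of_ramsey_not_mem_P {k : ℕ → ℕ} (h : ramseyLangAt k ∉ Classes.P) :
    cliqueFreeLangAt k ∉ Classes.P := fun hc => by
  apply h
  rw [ramseyLangAt_eq_inter]
  exact inter_mem_P hc ((cliqueFree_mem_P_iff k).1 hc)

/-! ## §10 The lattice of sufficient targets bottoms out at `CLIQUEFREE_{⌈2log₂n⌉} ∉ P` -/

/-- The threshold numeral is computable on codes: `(n, bits) ↦ ((n, bits), Nat.size (n·n − 1))`, and
`Nat.size (n·n − 1) = thr n`. [folklore] -/
theorem exists_thrPairFn : ∃ g ∈ FP, ∀ (n : ℕ) (G : SimpleGraph (Fin n)),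
    g (encodingGraph.encode ⟨n, G⟩) = boolPair (encodingGraph.encode ⟨n, G⟩) (encodeNat (thr n)) := by
  have hn : CodeFP (CodeFP.pairE CodeFP.natE CodeFP.strE) CodeFP.natE (fun q : ℕ × List Bool => q.1) :=
    CodeFP.fst _ _
  have hsize : CodeFP CodeFP.natE CodeFP.natE Nat.size :=
    (CodeFP.strNatLength.comp CodeFP.strOfNat).congr fun m => CodeFP.length_natE m
  have hk : CodeFP (CodeFP.pairE CodeFP.natE CodeFP.strE) CodeFP.natE
      (fun q : ℕ × List Bool => Nat.size (q.1 * q.1 - 1)) :=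
    hsize.comp (CodeFP.natSub.comp ((CodeFP.natMul.comp (hn.pair hn)).pair (CodeFP.const _ 1)))
  obtain ⟨g, hg, hspec⟩ := (CodeFP.id _).pair hk
  refine ⟨g, hg, fun n G => ?_⟩
  have h := hspec (n, CliqueNP.adjBits n G)
  dsimp only [id] at h
  rw [Summit.PneNP.PneNP.Theorems.RamseyUncertifiableRamseyInCoNP.size_mul_self_pred] at h
  rw [HamNP.encode_eq]
  exact h

/-- **`CLIQUEFREE_{⌈2log₂n⌉} ∈ coNP`** (the complement is "not a code word, or CLIQUE at `k = thr n`";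
`CLIQUE_mem_NP` pulled back along the threshold pairing). [folklore] -/
theorem cliqueFreeLang_thr_mem_coNP : cliqueFreeLangAt thr ∈ coNP := by
  obtain ⟨g, hg, hspec⟩ := exists_thrPairFn
  have heq : (cliqueFreeLangAt thr)ᶜ = HamNP.gcodeLangᶜ ⊔ (HamNP.gcodeLang ⊓ (g ⁻¹' CLIQUE : Language Bool)) := by
    refine Set.ext fun x => ⟨fun hx => ?_, ?_⟩
    · by_cases hc : x ∈ HamNP.gcodeLang
      · obtain ⟨n, G, rfl⟩ := (HamNP.mem_gcodeLang_iff x).1 hc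
        refine Or.inr ⟨hc, ?_⟩
        show g (encodingGraph.encode ⟨n, G⟩) ∈ CLIQUE
        rw [hspec]
        refine ⟨(⟨n, G⟩, thr n), ?_, rfl⟩
        show ¬ G.CliqueFree (thr n)
        intro hG
        exact hx ⟨⟨n, G⟩, hG, rfl⟩
      · exact Or.inl hc
    · rintro (hc | ⟨hc, hgx⟩) hx
      · obtain ⟨⟨n, G⟩, -, rfl⟩ := hx
        exact hc ((HamNP.mem_gcodeLang_iff _).2 ⟨n, G, rfl⟩)
      · obtain ⟨⟨n, G⟩, hG, rfl⟩ := hx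
        have hgx' : g (encodingGraph.encode ⟨n, G⟩) ∈ CLIQUE := hgx
        rw [hspec] at hgx'
        obtain ⟨⟨⟨m, H⟩, k'⟩, hH, he⟩ := hgx'
        have he' : (⟨m, H⟩, k') = ((⟨n, G⟩ : Σ n, SimpleGraph (Fin n)), thr n) :=
          (encodingGraph.pairBool encodingNatBool).encode_injective he
        rw [he'] at hH
        exact hH hG
  show (cliqueFreeLangAt thr)ᶜ ∈ Nondeterministic.NP
  rw [heq]
  exact union_P_mem_polyExists (K := Classes.P) (fun _ _ a b => union_mem_P a b)
    (compl_mem_P_iff.2 HamNP.gcodeLang_mem_P)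
    (inter_P_mem_polyExists (K := Classes.P) (fun _ _ a b => inter_mem_P a b) HamNP.gcodeLang_mem_P
      (preimage_mem_NP CLIQUE_mem_NP hg))

/-- **The bottom of the lattice closes the summit** (stated contrapositively: no summit conclusion in
this file): if the summit fails then `CLIQUEFREE_{⌈2log₂n⌉} ∈ P`; i.e. "no polynomial-time algorithm decides
`ω(G) < ⌈2 log₂ n⌉`" (the classical LOGCLIQUE ∉ P, implied by ETH) already gives the summit. [folklore] -/
theorem cliqueFreeLang_thr_mem_P_of_not_pneNP (hne : ¬ PneNP) : cliqueFreeLangAt thr ∈ Classes.P :=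
  coNP_eq_P_of_not_pneNP hne ▸ cliqueFreeLang_thr_mem_coNP

/-- **The lattice.** `RamseyNotNP` (two-sided, `∉ NP`) ⟹ `CLIQUEFREE_thr ∉ NP` ⟹ `CLIQUEFREE_thr ∉ P`, and
`RamseyNotNP` ⟹ `RAMSEY₂ ∉ P` ⟹ `CLIQUEFREE_thr ∉ P`; and (contrapositively) the bottom node already closes
the summit.  The crux as filed is the TOP of this lattice. [folklore] -/
theorem targetLattice :
    (RamseyNotNP → cliqueFreeLangAt thr ∉ Nondeterministic.NP) ∧
    (cliqueFreeLangAt thr ∉ Nondeterministic.NP → cliqueFreeLangAt thr ∉ Classes.P) ∧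
    (RamseyNotNP → ramseyLangAt thr ∉ Classes.P) ∧
    (ramseyLangAt thr ∉ Classes.P → cliqueFreeLangAt thr ∉ Classes.P) ∧
    (¬ PneNP → cliqueFreeLangAt thr ∈ Classes.P) :=
  ⟨fun hX => cliqueFree_not_mem_NP_of_ramseyNotNPAt (k := thr) hX, fun h hc => h (P_subset_NP_holds hc),
    ramseyNotP_of_ramseyNotNP, fun h => cliqueFree_not_mem_P_of_ramsey_not_mem_P (k := thr) h,
    cliqueFreeLang_thr_mem_P_of_not_pneNP⟩


/-- **A one-sided certificate scheme already refutes the crux**: `CLIQUEFREE_{⌈2log₂n⌉} ∈ NP → ¬ RamseyNotNP`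
(contrapositive of `cliqueFree_not_mem_NP_of_ramseyNotNPAt`). [folklore] -/
theorem not_ramseyNotNP_of_cliqueFree_mem_NP (h : cliqueFreeLangAt thr ∈ Nondeterministic.NP) :
    ¬ RamseyNotNP :=
  fun hX => cliqueFree_not_mem_NP_of_ramseyNotNPAt (k := thr) hX h

/-- **A polynomial-time LOGCLIQUE algorithm already refutes the crux**: `CLIQUEFREE_{⌈2log₂n⌉} ∈ P →
¬ RamseyNotNP`. [folklore] -/
theorem not_ramseyNotNP_of_cliqueFree_mem_P (h : cliqueFreeLangAt thr ∈ Classes.P) : ¬ RamseyNotNP :=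
  not_ramseyNotNP_of_cliqueFree_mem_NP (P_subset_NP_holds h)

/-! ## §11 A data point between the dead zones: the threshold `k n = n` gives an infinite language in `P`

At `k n = n` the Ramsey set is the set of NON-HOMOGENEOUS graphs (`G ≠ ⊤`, `G ≠ ⊥`, `n ≥ 2`): infinite and
co-infinite among code words, yet in `P` — the necessary conditions of §5 are far from sufficient, and the
crux shape is NOT monotone in the threshold (dead for `4^k ≤ n`, conjectured at `2log₂ n`, plausibly
`⟺ coNP ≠ NP` at polynomial thresholds `n^ε` by padding CLIQUE into explicit Frankl–Wilson hosts — not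
formalised —, dead again from `k = n` on). -/

/-- The non-homogeneity test on the fields of a code: some bit is set, and some off-diagonal bit is clear.
[folklore] -/
def nonHomTest (q : ℕ × List Bool) : Bool :=
  ((List.range q.2.length).any fun t => q.2.getD t false) &&
    ((List.range q.2.length).any fun t => (!q.2.getD t false) && !decide (t / q.1 = t % q.1))

/-- `nonHomTest` is computed on codes in polynomial time. [folklore] -/
theorem nonHomTest_codeFP : CodeFP (CodeFP.pairE CodeFP.natE CodeFP.strE) CodeFP.bitE nonHomTest := by
  have hn : CodeFP (CodeFP.pairE CodeFP.natE CodeFP.strE) CodeFP.natE (fun q : ℕ × List Bool => q.1) :=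
    CodeFP.fst _ _
  have hbits : CodeFP (CodeFP.pairE CodeFP.natE CodeFP.strE) CodeFP.strE (fun q : ℕ × List Bool => q.2) :=
    CodeFP.snd _ _
  have hrange : CodeFP (CodeFP.pairE CodeFP.natE CodeFP.strE) (CodeFP.rawE CodeFP.natE)
      (fun q : ℕ × List Bool => List.range q.2.length) :=
    CodeFP.urange.comp (CodeFP.strLength.comp hbits)
  have gn : CodeFP (CodeFP.pairE (CodeFP.pairE CodeFP.natE CodeFP.strE) CodeFP.natE) CodeFP.natE
      (fun r : (ℕ × List Bool) × ℕ => r.1.1) := hn.comp (CodeFP.fst _ _)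
  have gbits : CodeFP (CodeFP.pairE (CodeFP.pairE CodeFP.natE CodeFP.strE) CodeFP.natE) CodeFP.strE
      (fun r : (ℕ × List Bool) × ℕ => r.1.2) := hbits.comp (CodeFP.fst _ _)
  have gt : CodeFP (CodeFP.pairE (CodeFP.pairE CodeFP.natE CodeFP.strE) CodeFP.natE) CodeFP.natE
      (fun r : (ℕ × List Bool) × ℕ => r.2) := CodeFP.snd _ _
  have gb : CodeFP (CodeFP.pairE (CodeFP.pairE CodeFP.natE CodeFP.strE) CodeFP.natE) CodeFP.bitE
      (fun r : (ℕ × List Bool) × ℕ => r.1.2.getD r.2 false) :=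
    CodeFP.strGetDNat.comp (gbits.pair gt)
  have gd : CodeFP (CodeFP.pairE (CodeFP.pairE CodeFP.natE CodeFP.strE) CodeFP.natE) CodeFP.bitE
      (fun r : (ℕ × List Bool) × ℕ => decide (r.2 / r.1.1 = r.2 % r.1.1)) :=
    CodeFP.natEq.comp ((CodeFP.natDiv.comp (gt.pair gn)).pair (CodeFP.natMod.comp (gt.pair gn)))
  have e1 : CodeFP (CodeFP.pairE CodeFP.natE CodeFP.strE) CodeFP.bitE
      (fun q : ℕ × List Bool => (List.range q.2.length).any fun t => q.2.getD t false) :=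
    (CodeFP.any gb).comp ((CodeFP.id _).pair hrange)
  have e2 : CodeFP (CodeFP.pairE CodeFP.natE CodeFP.strE) CodeFP.bitE
      (fun q : ℕ × List Bool => (List.range q.2.length).any fun t =>
        (!q.2.getD t false) && !decide (t / q.1 = t % q.1)) :=
    (CodeFP.any (gb.not.and gd.not)).comp ((CodeFP.id _).pair hrange)
  exact e1.and e2

/-- An `n`-clique of a graph on `Fin n` is everything, so a missing edge excludes `n`-cliques. [folklore] -/
theorem cliqueFree_card_of_not_adj {n : ℕ} {G : SimpleGraph (Fin n)} {i j : Fin n} (hij : i ≠ j)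
    (h : ¬ G.Adj i j) : G.CliqueFree n := by
  intro s hs
  have hsu : s = Finset.univ :=
    Finset.eq_univ_of_card s (hs.card_eq.trans (Fintype.card_fin n).symm)
  subst hsu
  exact h (hs.isClique (Finset.mem_univ i) (Finset.mem_univ j) hij)

open Classical in
/-- **What the test decides**: on the code fields of `G`, `nonHomTest` holds iff `G` has no `n`-clique and
no `n`-independent set. [folklore] -/
theorem nonHomTest_adjBits (n : ℕ) (G : SimpleGraph (Fin n)) :
    nonHomTest (n, CliqueNP.adjBits n G) = true ↔ (G.CliqueFree n ∧ Gᶜ.CliqueFree n) := by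
  simp only [nonHomTest, CliqueNP.length_adjBits, Bool.and_eq_true, List.any_eq_true, List.mem_range,
    Bool.not_eq_true', decide_eq_false_iff_not]
  constructor
  · rintro ⟨⟨t, ht, hbit⟩, ⟨u, hu, hbit', hne⟩⟩
    rw [CliqueNP.getD_adjBits G ht, decide_eq_true_eq] at hbit
    rw [CliqueNP.getD_adjBits G hu] at hbit'
    have hadj' : ¬ G.Adj ⟨u / n, CliqueNP.div_lt_of_lt_mul hu⟩ ⟨u % n, Nat.mod_lt _ (CliqueNP.pos_of_lt_mul hu)⟩ := by
      intro h; rw [decide_eq_true h] at hbit'; exact Bool.noConfusion hbit'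
    refine ⟨cliqueFree_card_of_not_adj (fun h => hne (by simpa using congrArg Fin.val h)) hadj', ?_⟩
    refine cliqueFree_card_of_not_adj (G := Gᶜ) (G.ne_of_adj hbit) ?_
    rw [SimpleGraph.compl_adj]
    exact fun h => h.2 hbit
  · rintro ⟨hG, hGc⟩
    constructor
    · -- `G ≠ ⊥`: otherwise `Gᶜ = ⊤` has an `n`-clique
      by_contra hno
      push Not at hno
      apply not_cliqueFree_top (le_refl n)
      have : Gᶜ = ⊤ := by
        ext i j
        simp only [SimpleGraph.compl_adj, SimpleGraph.top_adj, ne_eq, and_iff_left_iff_imp]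
        intro hij hadj
        have h := hno (i * n + j) (CliqueNP.flat_lt i j)
        rw [CliqueNP.getD_adjBits_flat, decide_eq_true hadj] at h
        exact h rfl
      rw [← this]; exact hGc
    · -- `G ≠ ⊤`: otherwise `G` has an `n`-clique
      by_contra hno
      push Not at hno
      apply not_cliqueFree_top (le_refl n)
      have : G = ⊤ := by
        ext i j
        simp only [SimpleGraph.top_adj, ne_eq]
        constructor
        · exact fun h => G.ne_of_adj h
        · intro hij
          have h := hno (i * n + j) (CliqueNP.flat_lt i j)
          rw [CliqueNP.getD_adjBits_flat, CliqueNP.flat_div, CliqueNP.flat_mod] at h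
          by_contra hadj
          exact hij (Fin.ext (h (decide_eq_false hadj)))
      rw [← this]; exact hG

/-- **The threshold `n` language is in `P`** (code-word test ∧ non-homogeneity test). [folklore] -/
theorem ramseyLangAt_self_mem_P : ramseyLangAt (fun n => n) ∈ Classes.P := by
  obtain ⟨f, hf, hspec⟩ := nonHomTest_codeFP
  have key : ∀ (n : ℕ) (G : SimpleGraph (Fin n)),
      f (encodingGraph.encode ⟨n, G⟩) = [nonHomTest (n, CliqueNP.adjBits n G)] := fun n G => by
    rw [HamNP.encode_eq]; exact hspec (n, CliqueNP.adjBits n G)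
  have heq : ramseyLangAt (fun n => n) = HamNP.gcodeLang ⊓ ({x | f x = [true]} : Language Bool) := by
    refine Set.ext fun x => ⟨?_, ?_⟩
    · rintro ⟨⟨n, G⟩, hG, rfl⟩
      refine ⟨(HamNP.mem_gcodeLang_iff _).2 ⟨n, G, rfl⟩, ?_⟩
      show f (encodingGraph.encode ⟨n, G⟩) = [true]
      rw [key, (nonHomTest_adjBits n G).2 hG]
    · rintro ⟨hx, hfx⟩
      obtain ⟨n, G, rfl⟩ := (HamNP.mem_gcodeLang_iff x).1 hx
      have hfx' : f (encodingGraph.encode ⟨n, G⟩) = [true] := hfx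
      rw [key] at hfx'
      exact ⟨⟨n, G⟩, (nonHomTest_adjBits n G).1 (List.cons.inj hfx').1, rfl⟩
  rw [heq]
  exact inter_mem_P HamNP.gcodeLang_mem_P (setOf_apply_eq_apply_mem_P hf (const_mem_FP [true]))

/-- **`¬ RamseyNotNPAt (fun n => n)`.** [folklore] -/
theorem not_ramseyNotNPAt_self : ¬ RamseyNotNPAt (fun n => n) :=
  fun h => h (P_subset_NP_holds ramseyLangAt_self_mem_P)

/-- The threshold-`n` language is nevertheless infinite: a single edge on `m + 3` vertices is
non-homogeneous. [folklore] -/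
theorem ramseySetAt_self_infinite : (ramseySetAt fun n => n).Infinite := by
  let Gm : ∀ m : ℕ, SimpleGraph (Fin (m + 3)) := fun m =>
    SimpleGraph.fromRel fun i j : Fin (m + 3) => i.val = 0 ∧ j.val = 1
  have hmem : ∀ m : ℕ, (⟨m + 3, Gm m⟩ : Σ n, SimpleGraph (Fin n)) ∈ ramseySetAt fun n => n := by
    intro m
    have h01 : (Gm m).Adj ⟨0, by omega⟩ ⟨1, by omega⟩ := by
      simp [Gm, SimpleGraph.fromRel_adj]
    have h02 : ¬ (Gm m).Adj ⟨0, by omega⟩ ⟨2, by omega⟩ := by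
      simp [Gm, SimpleGraph.fromRel_adj]
    show (Gm m).CliqueFree (m + 3) ∧ (Gm m)ᶜ.CliqueFree (m + 3)
    refine ⟨cliqueFree_card_of_not_adj (i := ⟨0, by omega⟩) (j := ⟨2, by omega⟩) (by simp) h02, ?_⟩
    refine cliqueFree_card_of_not_adj (G := (Gm m)ᶜ) (i := ⟨0, by omega⟩) (j := ⟨1, by omega⟩)
      (by simp) ?_
    rw [SimpleGraph.compl_adj]
    exact fun h => h.2 h01
  have hinj : Function.Injective fun m : ℕ => (⟨m + 3, Gm m⟩ : Σ n, SimpleGraph (Fin n)) := by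
    intro a b hab
    have := congrArg Sigma.fst hab
    simpa using this
  exact Set.infinite_of_injective_forall_mem hinj hmem


/-! ## §12 — Line `Sketch` (PICKED 2026-08-16; card typical-one-sided-capture ⊕ planting-map-demibit; `SketchIdeator1.lean`)

Stubs of the picked line: `TypicalCliqueCapture` (TCC, held by the lead; conjecture-grade), `RamseyDense`
(quantitative Erdős; provable), `NondetPlantedRefutation ε` + `ThresholdBelowPoly ε` (⟹ TCC).  Joint
sufficiency `TCC → RamseyDense → X` is kernel-checked in the skeleton — no gap.  Cheap attacks:

* TCC: not cheaply refutable (a refutation = an NP subset of CLIQUEFREE_thr of density → 1, i.e. poly-size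
  certificates of `ω < ⌈2log₂n⌉` for asymptotically all graphs — nondeterministic planted-clique refutation
  at `k = 2log₂ n`, open; `S = ∅` and finite `S` satisfy TCC's conclusion trivially).  TCC is the
  DENSITY-immunity strengthening of `CLIQUEFREE_thr ∉ NP` (§9: already forced by X), so it implies
  `coNP ≠ NP` on its own.
* `RamseyDense`: true (non-Ramsey fraction `≤ 2·C(n,k)·2^{-C(k,2)} ≤ 2^{1+k/2}/k! → 0`, cf. §5'); the strict
  `<` needs `countAt ramseySet n > 0` for `c ≥ 1`, fine for `n ≥ 3`.
* PARAMETER RANGE of the planted stubs (recorded below): `ThresholdBelowPoly ε` is FALSE for `ε ≥ 1/2`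
  (`not_thresholdBelowPoly_of_half_le`), and on paper `NondetPlantedRefutation ε` is FALSE for `ε < 0`
  (the `P` language `{G : ϑ(Ḡ) < n^{1/2+|ε|}}` has density → 1 by Juhász 1982 and certifies
  `ω < n^{1/2+|ε|}`; not formalisable here — no concentration of ϑ on G(n,½) in the tree) and TRIVIALLY TRUE
  for `ε ≥ 1/2` (its hypothesis forces `S` to have no large members).  So the line must instantiate
  `0 < ε < 1/2` (BHKKMP16 regime); nothing is mis-stated, the skeleton says "true for ε < 1/2".
* Merged card `planting-map-demibit` (`SketchIdeator2.lean`): its `RamseyDense` (`total ≤ 2·countIn` for `n ≥ 3`)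
  is true (union bound ≤ 1/3 from `k = 4` on; triage table), `DenseBreakerMeetsPlanted` (X_{1/2}) and
  `PlantingIsDemiBit` are not cheaply refutable (a refutation = an NP family of certified Ramsey graphs of
  density ≥ 1/2, resp. ≥ n^{-c} i.o. — open), and the glue `ramseyNotNP_of_dense` is proved; its immunity apex
  is correctly marked dead-in-spirit (cf. §7).
* The skeleton's calibration item `XImpliesY : RamseyNotNP → CliqueSideNotNP` is PROVED here:
  `cliqueSideNotNP_of_ramseyNotNP` (= §9 `cliqueFree_not_mem_NP_of_ramseyNotNPAt` at `k = thr`; lands in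
  `Negative/ComplementSymmetry.lean`). -/

namespace LineSketch

/-- Verbatim copy of the skeleton's `kk` (`SketchIdeator1.lean`; Cruxes modules are not importable targets).
[folklore] -/
def kk (n : ℕ) : ℕ := Nat.clog 2 (n ^ 2)

/-- Verbatim copy of the skeleton's stub `ThresholdBelowPoly ε`. [folklore] -/
def ThresholdBelowPoly (ε : ℝ) : Prop := ∃ N : ℕ, ∀ n ≥ N, kk n ≤ ⌈(n : ℝ) ^ (1 / 2 - ε)⌉₊

/-- **Load-bearing parameter range**: `ThresholdBelowPoly ε` FAILS for every `ε ≥ 1/2` (then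
`n^{1/2-ε} ≤ 1 < 2 ≤ ⌈2log₂ n⌉`). [folklore] -/
theorem not_thresholdBelowPoly_of_half_le {ε : ℝ} (hε : 1 / 2 ≤ ε) : ¬ ThresholdBelowPoly ε := by
  rintro ⟨N, hN⟩
  have h := hN (max N 2) (le_max_left _ _)
  have h2 : 2 ≤ max N 2 := le_max_right _ _
  have hceil : ⌈((max N 2 : ℕ) : ℝ) ^ (1 / 2 - ε)⌉₊ ≤ 1 := by
    refine Nat.ceil_le.2 ?_
    simpa using Real.rpow_le_one_of_one_le_of_nonpos (by exact_mod_cast (by omega : 1 ≤ max N 2)) (by linarith)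
  have hkk : 2 ≤ kk (max N 2) := by
    unfold kk
    by_contra hlt
    push Not at hlt
    have := (Nat.clog_le_iff_le_pow one_lt_two).1 (Nat.lt_succ_iff.1 hlt)
    nlinarith
  omega

/-- `ThresholdBelowPoly (1/2)` is false (the boundary case). [folklore] -/
theorem not_thresholdBelowPoly_half : ¬ ThresholdBelowPoly (1 / 2) :=
  not_thresholdBelowPoly_of_half_le le_rfl

/-- **The skeleton's `XImpliesY`, PROVED**: `RamseyNotNP → CliqueSideNotNP` (the clique-side shadow is forced
by the crux; §9). [folklore] -/
theorem cliqueSideNotNP_of_ramseyNotNP (hX : RamseyNotNP) :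
    encodingGraph.toLanguage {p : Σ n, SimpleGraph (Fin n) | p.2.CliqueFree (Nat.clog 2 (p.1 ^ 2))} ∉
      Nondeterministic.NP :=
  cliqueFree_not_mem_NP_of_ramseyNotNPAt (k := thr) hX

end LineSketch

end Summit.PneNP.PneNP.Cruxes.RamseyNotNP.Disproof
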